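import Literature.Probability.Percolation.LonePortSumGeneral
import Literature.Probability.Percolation.KozmaNitzanClusterProperty
import HarnessLib

/-!
# Crux `PercNearOneGluing.AdditiveGluing` (stmt-CriticalPhenomena-4576), line `tieline`: the off-cluster disconnection functional

Support file (`--supports stmt-CriticalPhenomena-4576`; seat (d) exchange-certificate form, gen 33).  Tools for the proof of the
registered stub `stub_k0set3_g2` (K₀-set) in `…AdditiveGluingK0Set3.lean`.  No definitions, no named facts, no sorries.

Weighted graph on `Fin n` (`μ = prodBernoulli w`), target `b`, relay set `S`.  The (K₀-set) kernel and the SPLIT inequality are the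
tree's surplus transfer (S5) / master form (GEN) applied to ONE new monotone functional of the (vertex) cluster `K = C(x)`:

  `F(K) = 1{b ∈ K} + 1{b ∉ K} · μ{η | b ↮ S ∖ K in η with the pairs meeting K deleted}`

(spelled out as the hypothesis `hF` of every lemma; no `def` is introduced).  This file proves:
* `offF_mono`, `offF_nonneg` — `F` is monotone in `K` and nonnegative;
* `setIntegral_offF` — the MARKOV EVALUATION on any cluster event `{P(C(x))}`:
  `∫_{P(C(x))} F(C(x)) dμ = μ(P(C(x)) ∩ x ↔ b) + μ(P(C(x)) ∩ x ↮ b ∩ b ↮ S)` (given `C(x) = K ∌ b` the pairs off `K̄` are fresh —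
  `BHK2006.sum_cond_cluster_sdiff` — and `b ↮ S ∖ K` off `K̄` iff `b ↮ S`, `LonePortSumGeneral.reachable_sdiff_bar_iff`);
* `integral_offF_relay` — `∫ F(C(a)) = τ_a + μ(b ↮ S)` for `a ∈ S`; `setIntegral_offF_reach` —
  `∫_{u ↔ S} F(C(u)) = μ(u ↔ S ∩ u ↔ b) + μ(u ↔ S ∩ b ↮ S)`; `measureReal_reach_partition` —
  `μ(u ↔ S) = μ(u ↔ S ∩ u ↔ b) + μ(u ↔ S ∩ b ↮ S) + μ(u ↮ b ∩ u ↔ S ∩ S ↔ b)`.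
[cite: VandenbergHaggstromKahn2005, §1 pp. 7–8, display (10)] [cite: KozmaNitzan2024, Conj. 4 (p. 32)]
-/

namespace Summit.CriticalPhenomena.PercolationContinuityZ3.Cruxes.AdditiveGluing.TieLine

open MeasureTheory Set Literature.Probability.LatticeModels Literature.Probability.Percolation

noncomputable section
open Classical

namespace OffCluster

variable {n : ℕ}

/-! ### The off-cluster disconnection functional -/

/-- Monotonicity of the off-cluster disconnection functional
`F(K) = 1{b ∈ K} + 1{b ∉ K}·μ{b ↮ S ∖ K off the pairs meeting K}` in the vertex set `K`. [folklore] -/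
theorem offF_mono (w : Sym2 (Fin n) → unitInterval) (S : Finset (Fin n)) (b : Fin n) (F : Set (Fin n) → ℝ)
    (hF : ∀ K, F K = if b ∈ K then (1 : ℝ) else (prodBernoulli w).real
      {η : BondConfig (Fin n) | ∀ s ∈ S, s ∉ K → ¬ (openGraph (η \ {e : Sym2 (Fin n) | ∃ v ∈ e, v ∈ K})).Reachable b s}) :
    ∀ K K' : Set (Fin n), K ⊆ K' → F K ≤ F K' := by
  intro K K' hKK'
  rw [hF K, hF K']
  by_cases hb' : b ∈ K'
  · rw [if_pos hb']
    split_ifs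
    · exact le_rfl
    · exact measureReal_le_one
  · have hb : b ∉ K := fun h => hb' (hKK' h)
    rw [if_neg hb, if_neg hb']
    refine measureReal_mono (fun η hη s hs hsK' hreach => ?_)
    refine hη s hs (fun h => hsK' (hKK' h)) (hreach.mono (openGraph_mono ?_))
    exact sdiff_subset_sdiff_right fun e ⟨v, hv, hvK⟩ => ⟨v, hv, hKK' hvK⟩

/-- Nonnegativity of the off-cluster disconnection functional. [folklore] -/
theorem offF_nonneg (w : Sym2 (Fin n) → unitInterval) (S : Finset (Fin n)) (b : Fin n) (F : Set (Fin n) → ℝ)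
    (hF : ∀ K, F K = if b ∈ K then (1 : ℝ) else (prodBernoulli w).real
      {η : BondConfig (Fin n) | ∀ s ∈ S, s ∉ K → ¬ (openGraph (η \ {e : Sym2 (Fin n) | ∃ v ∈ e, v ∈ K})).Reachable b s}) :
    ∀ K : Set (Fin n), 0 ≤ F K := by
  intro K
  rw [hF K]
  split_ifs
  · exact zero_le_one
  · exact measureReal_nonneg

/-- Total mass of the product weights is `1`. [folklore] -/
theorem sum_weight_eq_one (w : Sym2 (Fin n) → unitInterval) :
    ∑ ω : Set (Sym2 (Fin n)), BHK2006.weight (fun e => (w e : ℝ)) ω = 1 := by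
  have h1 := BHK2006.integral_prodBernoulli_eq_sum w fun _ => (1 : ℝ)
  simp only [integral_const, probReal_univ, smul_eq_mul, mul_one] at h1
  exact h1.symm

/-- `μ(C)` as a weighted sum over configurations. [folklore] -/
theorem measureReal_eq_sum_weight (w : Sym2 (Fin n) → unitInterval) (C : Set (BondConfig (Fin n))) :
    (prodBernoulli w).real C = ∑ η : Set (Sym2 (Fin n)), BHK2006.weight (fun e => (w e : ℝ)) η * (if η ∈ C then 1 else 0) := by
  rw [← integral_indicator_one (MeasurableSet.of_discrete), BHK2006.integral_prodBernoulli_eq_sum]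
  refine Finset.sum_congr rfl fun η _ => ?_
  by_cases h : η ∈ C
  · rw [indicator_of_mem h, Pi.one_apply, if_pos h]
  · rw [indicator_of_notMem h, if_neg h]

/-- **Markov evaluation of the off-cluster disconnection functional on a cluster event.**  For every cluster property `P`
of the (vertex) cluster `C(x)`:
`∫_{P(C(x))} F(C(x)) dμ = μ(P(C(x)) ∩ {x ↔ b}) + μ(P(C(x)) ∩ {x ↮ b} ∩ {b ↮ S})` — given `C(x) = K ∌ b`, the pairs off `K̄` are
fresh, and `b ↮ S ∖ K` off `K̄` iff `b ↮ S` (an open path from `b ∉ K` meets no pair of `K̄`).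
[cite: VandenbergHaggstromKahn2005, §1 pp. 7–8, display (10)] -/
theorem setIntegral_offF (w : Sym2 (Fin n) → unitInterval) (S : Finset (Fin n)) (b x : Fin n) (F : Set (Fin n) → ℝ)
    (hF : ∀ K, F K = if b ∈ K then (1 : ℝ) else (prodBernoulli w).real
      {η : BondConfig (Fin n) | ∀ s ∈ S, s ∉ K → ¬ (openGraph (η \ {e : Sym2 (Fin n) | ∃ v ∈ e, v ∈ K})).Reachable b s})
    (P : Set (Fin n) → Prop) :
    ∫ ω in {ω : BondConfig (Fin n) | P (openCluster ω x)}, F (openCluster ω x) ∂(prodBernoulli w) =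
      (prodBernoulli w).real ({ω : BondConfig (Fin n) | P (openCluster ω x)} ∩ openConn x b) +
        (prodBernoulli w).real ({ω : BondConfig (Fin n) | P (openCluster ω x)} ∩ (openConn x b)ᶜ ∩
          {ω | ∀ s ∈ S, ¬ (openGraph ω).Reachable b s}) := by
  set μ := prodBernoulli w with hμ
  set w' : Sym2 (Fin n) → ℝ := fun e => (w e : ℝ) with hw'
  set E : Set (BondConfig (Fin n)) := {ω | P (openCluster ω x)} with hE
  have hmeas : ∀ A : Set (BondConfig (Fin n)), MeasurableSet A := fun _ => MeasurableSet.of_discrete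
  -- the vertex span of an edge set and the cluster
  set V : Set (Sym2 (Fin n)) → Set (Fin n) := fun C => {a | a = x ∨ ∃ e ∈ C, a ∈ e} with hVdef
  have hV : ∀ ω : BondConfig (Fin n), V (openEdgeCluster ω x) = openCluster ω x := fun ω =>
    (KNPreFKG.openCluster_eq_setOf_openEdgeCluster ω x).symm
  have hbar : ∀ C : Set (Sym2 (Fin n)),
      {e : Sym2 (Fin n) | ∃ v ∈ e, v ∈ V C} = {e | ∃ v ∈ e, v = x ∨ ∃ e' ∈ C, v ∈ e'} := fun C => rfl
  -- the off-cluster part of `F`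
  set off : Set (Fin n) → Set (BondConfig (Fin n)) := fun K =>
    {η | ∀ s ∈ S, s ∉ K → ¬ (openGraph (η \ {e : Sym2 (Fin n) | ∃ v ∈ e, v ∈ K})).Reachable b s} with hoff
  -- pointwise split of the integrand
  have hsplit : ∀ ω : BondConfig (Fin n), E.indicator (fun ω => F (openCluster ω x)) ω =
      (E ∩ openConn x b).indicator 1 ω + (E ∩ (openConn x b)ᶜ).indicator (fun ω => μ.real (off (openCluster ω x))) ω := by
    intro ω
    by_cases hω : ω ∈ E
    · by_cases hb : ω ∈ (openConn x b : Set (BondConfig (Fin n)))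
      · have hb' : b ∈ openCluster ω x := hb
        rw [indicator_of_mem hω, indicator_of_mem (mem_inter hω hb), Pi.one_apply,
          indicator_of_notMem (fun h => h.2 hb), hF, if_pos hb', add_zero]
      · have hb' : b ∉ openCluster ω x := hb
        rw [indicator_of_mem hω, indicator_of_notMem (fun h => hb h.2), indicator_of_mem (mem_inter hω hb), hF,
          if_neg hb', zero_add]
    · rw [indicator_of_notMem hω, indicator_of_notMem (fun h => hω h.1), indicator_of_notMem (fun h => hω h.1), add_zero]
  have hint : ∫ ω in E, F (openCluster ω x) ∂μ =
      μ.real (E ∩ openConn x b) + ∫ ω, (E ∩ (openConn x b)ᶜ).indicator (fun ω => μ.real (off (openCluster ω x))) ω ∂μ := by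
    rw [← integral_indicator (hmeas E), show E.indicator (fun ω => F (openCluster ω x)) =
      fun ω => (E ∩ openConn x b).indicator 1 ω + (E ∩ (openConn x b)ᶜ).indicator
        (fun ω => μ.real (off (openCluster ω x))) ω from funext hsplit,
      integral_add (Integrable.of_finite) (Integrable.of_finite), integral_indicator_one (hmeas _)]
  rw [hint]
  congr 1
  -- the second integral, by conditioning on the cluster of `x`
  set Kf : Set (Sym2 (Fin n)) → Set (Sym2 (Fin n)) → ℝ := fun C ξ =>
    (if P (V C) ∧ b ∉ V C then (1 : ℝ) else 0) *
      (if ∀ s ∈ S, s ∉ V C → ¬ (openGraph ξ).Reachable b s then (1 : ℝ) else 0) with hKf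
  have hm : ∑ ω, BHK2006.weight w' ω = 1 := sum_weight_eq_one w
  have key := BHK2006.sum_cond_cluster_sdiff w' hm x Kf
  -- right-hand side of `key` = the second integral
  have hoffsum : ∀ K : Set (Fin n), μ.real (off K) =
      ∑ η : Set (Sym2 (Fin n)), BHK2006.weight w' η *
        (if ∀ s ∈ S, s ∉ K → ¬ (openGraph (η \ {e : Sym2 (Fin n) | ∃ v ∈ e, v ∈ K})).Reachable b s
          then (1 : ℝ) else 0) := by
    intro K
    rw [hμ, measureReal_eq_sum_weight]
    refine Finset.sum_congr rfl fun η _ => ?_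
    congr 1
    by_cases h : η ∈ off K
    · rw [if_pos h, if_pos (by simpa only [hoff, mem_setOf_eq] using h)]
    · rw [if_neg h, if_neg (by simpa only [hoff, mem_setOf_eq] using h)]
  have hR : ∫ ω, (E ∩ (openConn x b)ᶜ).indicator (fun ω => μ.real (off (openCluster ω x))) ω ∂μ =
      ∑ ω, BHK2006.weight w' ω * ∑ η, BHK2006.weight w' η *
        Kf (openEdgeCluster ω x) (η \ {e | ∃ v ∈ e, v = x ∨ ∃ e' ∈ openEdgeCluster ω x, v ∈ e'}) := by
    rw [hμ, BHK2006.integral_prodBernoulli_eq_sum]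
    refine Finset.sum_congr rfl fun ω _ => ?_
    congr 1
    simp only [hKf]
    rw [← hbar (openEdgeCluster ω x)]
    simp only [hV ω]
    by_cases hω : ω ∈ E ∩ (openConn x b)ᶜ
    · have hP : P (openCluster ω x) ∧ b ∉ openCluster ω x := ⟨hω.1, fun h => hω.2 h⟩
      rw [indicator_of_mem hω, hoffsum]
      refine Finset.sum_congr rfl fun η _ => ?_
      rw [if_pos hP, one_mul]
    · have hP : ¬ (P (openCluster ω x) ∧ b ∉ openCluster ω x) := fun h => hω ⟨h.1, fun h' => h.2 h'⟩
      rw [indicator_of_notMem hω]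
      symm
      refine Finset.sum_eq_zero fun η _ => ?_
      rw [if_neg hP, zero_mul, mul_zero]
  -- left-hand side of `key` = the measure
  have hL : ∑ ω, BHK2006.weight w' ω *
        Kf (openEdgeCluster ω x) (ω \ {e | ∃ v ∈ e, v = x ∨ ∃ e' ∈ openEdgeCluster ω x, v ∈ e'}) =
      μ.real (E ∩ (openConn x b)ᶜ ∩ {ω | ∀ s ∈ S, ¬ (openGraph ω).Reachable b s}) := by
    rw [hμ, measureReal_eq_sum_weight]
    refine Finset.sum_congr rfl fun ω _ => ?_
    congr 1
    simp only [hKf, hV ω]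
    by_cases hω : ω ∈ E ∩ (openConn x b)ᶜ ∩ {ω | ∀ s ∈ S, ¬ (openGraph ω).Reachable b s}
    · rw [if_pos hω]
      have hP : P (openCluster ω x) ∧ b ∉ openCluster ω x := ⟨hω.1.1, fun h => hω.1.2 h⟩
      have hQ : ∀ s ∈ S, s ∉ openCluster ω x →
          ¬ (openGraph (ω \ {e | ∃ v ∈ e, v = x ∨ ∃ e' ∈ openEdgeCluster ω x, v ∈ e'})).Reachable b s :=
        fun s hs _ h => hω.2 s hs (h.mono (openGraph_mono sdiff_subset))
      rw [if_pos hP, if_pos hQ, one_mul]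
    · rw [if_neg hω]
      by_cases hP : P (openCluster ω x) ∧ b ∉ openCluster ω x
      · have hxb : ¬ (openGraph ω).Reachable x b := hP.2
        have hQ : ¬ (∀ s ∈ S, s ∉ openCluster ω x →
            ¬ (openGraph (ω \ {e | ∃ v ∈ e, v = x ∨ ∃ e' ∈ openEdgeCluster ω x, v ∈ e'})).Reachable b s) := by
          intro h
          refine hω ⟨⟨hP.1, hP.2⟩, fun s hs hbs => ?_⟩
          have hsK : s ∉ openCluster ω x := fun hxs => hxb (SimpleGraph.Reachable.trans hxs hbs.symm)
          exact h s hs hsK ((LonePortSumGeneral.reachable_sdiff_bar_iff hxb s).2 hbs)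
        rw [if_pos hP, if_neg hQ, mul_zero]
      · rw [if_neg hP, zero_mul]
  rw [hR, ← key, hL]

/-! ### Evaluations of the functional used by the assembly -/

/-- **Relay means**: for `a ∈ S`, `∫ F(C(a)) dμ = τ_a + μ(b ↮ S)`. [cite: VandenbergHaggstromKahn2005, §1 pp. 7–8, display (10)] -/
theorem integral_offF_relay (w : Sym2 (Fin n) → unitInterval) (S : Finset (Fin n)) (b : Fin n) (F : Set (Fin n) → ℝ)
    (hF : ∀ K, F K = if b ∈ K then (1 : ℝ) else (prodBernoulli w).real
      {η : BondConfig (Fin n) | ∀ s ∈ S, s ∉ K → ¬ (openGraph (η \ {e : Sym2 (Fin n) | ∃ v ∈ e, v ∈ K})).Reachable b s})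
    (a : Fin n) (ha : a ∈ S) :
    ∫ ω, F (openCluster ω a) ∂(prodBernoulli w) =
      (prodBernoulli w).real (openConn a b) + (prodBernoulli w).real {ω : BondConfig (Fin n) | ∀ s ∈ S, ¬ (openGraph ω).Reachable b s} := by
  have key := setIntegral_offF w S b a F hF (fun _ => True)
  have huniv : {ω : BondConfig (Fin n) | True} = univ := Set.setOf_true
  rw [huniv, setIntegral_univ, univ_inter, univ_inter] at key
  rw [key]
  have hsub : (openConn a b : Set (BondConfig (Fin n)))ᶜ ∩ {ω : BondConfig (Fin n) | ∀ s ∈ S, ¬ (openGraph ω).Reachable b s} =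
      {ω : BondConfig (Fin n) | ∀ s ∈ S, ¬ (openGraph ω).Reachable b s} :=
    inter_eq_right.2 fun ω hω hab => hω a ha (SimpleGraph.Reachable.symm hab)
  rw [hsub]

/-- **Observer evaluation**: `∫_{u ↔ S} F(C(u)) dμ = μ(u ↔ S ∩ u ↔ b) + μ(u ↔ S ∩ b ↮ S)`.
[cite: VandenbergHaggstromKahn2005, §1 pp. 7–8, display (10)] -/
theorem setIntegral_offF_reach (w : Sym2 (Fin n) → unitInterval) (S : Finset (Fin n)) (b : Fin n) (F : Set (Fin n) → ℝ)
    (hF : ∀ K, F K = if b ∈ K then (1 : ℝ) else (prodBernoulli w).real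
      {η : BondConfig (Fin n) | ∀ s ∈ S, s ∉ K → ¬ (openGraph (η \ {e : Sym2 (Fin n) | ∃ v ∈ e, v ∈ K})).Reachable b s})
    (u : Fin n) :
    ∫ ω in ⋃ s ∈ S, (openConn u s : Set (BondConfig (Fin n))), F (openCluster ω u) ∂(prodBernoulli w) =
      (prodBernoulli w).real ((⋃ s ∈ S, (openConn u s : Set (BondConfig (Fin n)))) ∩ openConn u b) +
        (prodBernoulli w).real ((⋃ s ∈ S, (openConn u s : Set (BondConfig (Fin n)))) ∩
          {ω : BondConfig (Fin n) | ∀ s ∈ S, ¬ (openGraph ω).Reachable b s}) := by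
  have hA : (⋃ s ∈ S, (openConn u s : Set (BondConfig (Fin n)))) = {ω | ∃ s ∈ S, s ∈ openCluster ω u} := by
    ext ω; simp only [mem_iUnion, mem_setOf_eq, exists_prop]; rfl
  have key := setIntegral_offF w S b u F hF (fun K => ∃ s ∈ S, s ∈ K)
  rw [← hA] at key
  have hsub : (⋃ s ∈ S, (openConn u s : Set (BondConfig (Fin n)))) ∩ (openConn u b)ᶜ ∩
        {ω : BondConfig (Fin n) | ∀ s ∈ S, ¬ (openGraph ω).Reachable b s} =
      (⋃ s ∈ S, (openConn u s : Set (BondConfig (Fin n)))) ∩ {ω : BondConfig (Fin n) | ∀ s ∈ S, ¬ (openGraph ω).Reachable b s} := by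
    ext ω
    simp only [mem_inter_iff, mem_compl_iff]
    constructor
    · rintro ⟨⟨h1, -⟩, h3⟩; exact ⟨h1, h3⟩
    · rintro ⟨h1, h3⟩
      refine ⟨⟨h1, fun hub => ?_⟩, h3⟩
      obtain ⟨s, hs, hus⟩ : ∃ s ∈ S, ω ∈ (openConn u s : Set (BondConfig (Fin n))) := by
        simpa only [mem_iUnion, exists_prop] using h1
      exact h3 s hs (SimpleGraph.Reachable.trans (SimpleGraph.Reachable.symm hub) hus)
  rw [hsub] at key
  exact key

/-- **Partition of `{u ↔ S}`** by the position of `b`: `μ(u ↔ S) = μ(u ↔ S ∩ u ↔ b) + μ(u ↔ S ∩ b ↮ S) + μ(u ↮ b ∩ u ↔ S ∩ S ↔ b)`.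
[folklore] -/
theorem measureReal_reach_partition (w : Sym2 (Fin n) → unitInterval) (S : Finset (Fin n)) (b u : Fin n) :
    (prodBernoulli w).real (⋃ s ∈ S, (openConn u s : Set (BondConfig (Fin n)))) =
      (prodBernoulli w).real ((⋃ s ∈ S, (openConn u s : Set (BondConfig (Fin n)))) ∩ openConn u b) +
        (prodBernoulli w).real ((⋃ s ∈ S, (openConn u s : Set (BondConfig (Fin n)))) ∩
          {ω : BondConfig (Fin n) | ∀ s ∈ S, ¬ (openGraph ω).Reachable b s}) +
        (prodBernoulli w).real ((openConn u b)ᶜ ∩ (⋃ s ∈ S, (openConn u s : Set (BondConfig (Fin n)))) ∩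
          (⋃ s ∈ S, (openConn s b : Set (BondConfig (Fin n))))) := by
  set μ := prodBernoulli w with hμ
  have hmeas : ∀ A : Set (BondConfig (Fin n)), MeasurableSet A := fun _ => MeasurableSet.of_discrete
  set A : Set (BondConfig (Fin n)) := ⋃ s ∈ S, (openConn u s : Set (BondConfig (Fin n))) with hAdef
  set BS : Set (BondConfig (Fin n)) := ⋃ s ∈ S, (openConn s b : Set (BondConfig (Fin n))) with hBS
  have hQBS : {ω : BondConfig (Fin n) | ∀ s ∈ S, ¬ (openGraph ω).Reachable b s} = BSᶜ := by
    ext ω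
    simp only [hBS, mem_compl_iff, mem_iUnion, mem_setOf_eq, exists_prop, not_exists, not_and]
    exact ⟨fun h s hs hsb => h s hs (SimpleGraph.Reachable.symm hsb), fun h s hs hbs => h s hs (SimpleGraph.Reachable.symm hbs)⟩
  have h1 := measureReal_inter_add_sdiff (μ := μ) (s := A) (hmeas BS) (measure_ne_top _ _)
  have h2 := measureReal_inter_add_sdiff (μ := μ) (s := A ∩ BS) (hmeas (openConn u b)) (measure_ne_top _ _)
  have e1 : A \ BS = A ∩ {ω : BondConfig (Fin n) | ∀ s ∈ S, ¬ (openGraph ω).Reachable b s} := by rw [hQBS, sdiff_eq]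
  have e2 : A ∩ BS ∩ openConn u b = A ∩ openConn u b := by
    ext ω
    simp only [mem_inter_iff]
    constructor
    · rintro ⟨⟨h1, -⟩, h3⟩; exact ⟨h1, h3⟩
    · rintro ⟨h1, h3⟩
      refine ⟨⟨h1, ?_⟩, h3⟩
      obtain ⟨s, hs, hus⟩ : ∃ s ∈ S, ω ∈ (openConn u s : Set (BondConfig (Fin n))) := by
        simpa only [hAdef, mem_iUnion, exists_prop] using h1
      have : ω ∈ (openConn s b : Set (BondConfig (Fin n))) := SimpleGraph.Reachable.trans (SimpleGraph.Reachable.symm hus) h3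
      simpa only [hBS, mem_iUnion, exists_prop] using ⟨s, hs, this⟩
  have e3 : (A ∩ BS) \ openConn u b = (openConn u b)ᶜ ∩ A ∩ BS := by
    ext ω; simp only [mem_sdiff, mem_inter_iff, mem_compl_iff]; tauto
  rw [e1] at h1
  rw [e2, e3] at h2
  linarith

end OffCluster

end

end Summit.CriticalPhenomena.PercolationContinuityZ3.Cruxes.AdditiveGluing.TieLine
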